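import Summits.ResolutionOfSingularities.ResolutionOfSingularities.Theses.HomologicalConductor
import Summits.ResolutionOfSingularities.ResolutionOfSingularities.Theorems.HomologicalConductorNoZenoBirthDefs
import Summits.ResolutionOfSingularities.ResolutionOfSingularities.Theorems.HomologicalConductorNoZenoTowerNoetherian
import Summits.ResolutionOfSingularities.ResolutionOfSingularities.Theorems.HomologicalConductorNoZenoDim2RegularCentre
import Summits.ResolutionOfSingularities.ResolutionOfSingularities.Theorems.HomologicalConductorNoZenoIffKernel
import Summits.ResolutionOfSingularities.ResolutionOfSingularities.Theorems.NoZeno.Negative.SurfaceTowerDichotomy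

/-!
# Crux `NoZeno` (stmt-ResolutionOfSingularities-16483) — the surface kernel has NO regular stage;
# the surface stubs are CONTRADICTION claims

Route `ResolutionOfSingularities/HomologicalConductor`, crux
`Summit.ResolutionOfSingularities.ResolutionOfSingularities.Theses.HomologicalConductor.NoZeno`,
line `birth`, stubs `stub_kernelRankOneSurface` (v6) / `stub_sandwichedTermination` (v7, plan-1's
`SandwichSplit.lean`). Negative lane (`--supports` the crux item): structure lemmas, no Theses decl
is asserted; OURS (res-L0-w44-tri-1, BARRIER & DEFECT triage — joint-sufficiency / vacuity audit of
the line's surface stubs).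

FINDING. The stubs carry the kernel hypothesis
`hker : ∀ O', (∀ m, ∀ s ∈ T_m, s ∈ O' ∧ (s⁻¹ ∈ O' → s⁻¹ ∈ O)) → ¬ IsNoetherianRing O'`;
at `O' := O` it says `O` is NOT noetherian (`not_isNoetherianRing_of_hker`), and in transcendence
degree `≤ 2` it makes the tower EXHAUST `O` (`surfaceKernel_exhausts`, `SurfaceTowerDichotomy.lean`).
But a regular stage `T_m` FREEZES the tower (`tower_succ_eq_self_of_isRegularLocalRing`, iterated:
`tower_add_eq_of_isRegularLocalRing`), so an exhausting tower with a regular stage has `O = T_m`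
(`toSubring_eq_tower_of_exhausts_of_isRegularLocalRing`) and `O` noetherian
(`isNoetherianRing_of_exhausts_of_isRegularLocalRing`). Hence:
* `surfaceKernel_not_isRegularLocalRing_tower`: under `hker`, `tr.deg ≤ 2`, NO stage is regular;
* `surfaceKernel_conclusion_iff_false`: the stubs' conclusion `∃ m, IsRegularLocalRing (T_m)` is
  equivalent to `False` under their own hypotheses — the stubs assert that NO datum satisfies the
  kernel hypotheses (given `Persistence`, `StrictDrop`). A "non-vacuity certificate" for those
  hypotheses (CHAIN W4.4 v1 seat-table ask to tri-1: instantiate them at `HIrrDatum.hIrr_datum` with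
  `R := T₀` regular, `m₀ = 0`) is therefore IMPOSSIBLE short of refuting the stub modulo `P ∧ D`:
  at `hIrr_datum` the start `T₀ = k[x⁻¹,y⁻¹]_(x⁻¹,y⁻¹)` is regular, the tower is frozen, `hexh` and
  `hker` FAIL (the `𝔪`-adic prime divisor of `T₀` is a noetherian skeleton-dominator). Provers of
  the stubs must derive `False` from an infinite ALL-SINGULAR exhausting tower; idea cards must
  supply an invariant that cannot drop infinitely often along such a tower (the literal "no Zeno").

Kernel-only (axioms `propext`, `Classical.choice`, `Quot.sound`); no `def`, no named fact.
-/

set_option linter.dupNamespace false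

noncomputable section

namespace Summit.ResolutionOfSingularities.ResolutionOfSingularities.Theorems.NoZeno.Negative

open Summit.ResolutionOfSingularities.ResolutionOfSingularities.Theorems.NoZeno.Birth

variable {k K : Type} [Field k] [Field K] [Algebra k K]

/-- **A regular stage FREEZES the tower**: `T_(m+j) = T_m` for all `j`. [folklore] -/
theorem tower_add_eq_of_isRegularLocalRing (O : ValuationSubring K) (A : Subalgebra k K)
    (hk : ∀ c : k, algebraMap k K c ∈ O) (hfr : IsFractionRing ↥A K)
    (hAO : A.toSubring ≤ O.toSubring) (m : ℕ) (hreg : IsRegularLocalRing ↥(tower O A m))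
    (j : ℕ) : tower O A (m + j) = tower O A m := by
  induction j with
  | zero => rfl
  | succ j ih =>
    have hreg' : IsRegularLocalRing ↥(tower O A (m + j)) := by rw [ih]; exact hreg
    rw [Nat.add_succ, tower_succ_eq_self_of_isRegularLocalRing O A hk hfr hAO (m + j) hreg', ih]

/-- **An exhausting tower with a regular stage exhausts at that stage**: `O = T_m`. [folklore] -/
theorem toSubring_eq_tower_of_exhausts_of_isRegularLocalRing (O : ValuationSubring K)
    (A : Subalgebra k K) (hk : ∀ c : k, algebraMap k K c ∈ O) (hA : A.FG)
    (hfr : IsFractionRing ↥A K) (hAO : A.toSubring ≤ O.toSubring)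
    (hexh : ∀ x : K, x ∈ O → ∃ m : ℕ, x ∈ tower O A m) (m : ℕ)
    (hreg : IsRegularLocalRing ↥(tower O A m)) : (tower O A m).toSubring = O.toSubring := by
  refine le_antisymm (tn_tower_invariant O A hk hA hfr hAO m).2.1 fun x hx => ?_
  obtain ⟨m', hm'⟩ := hexh x hx
  rcases Nat.lt_or_ge m m' with h | h
  swap
  · exact d2rc_mem_tower_of_le O A h hm'
  · obtain ⟨j, rfl⟩ := Nat.exists_eq_add_of_lt h
    rw [Nat.add_assoc, tower_add_eq_of_isRegularLocalRing O A hk hfr hAO m hreg (j + 1)] at hm'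
    exact hm'

/-- **… hence `O` is noetherian.** [folklore] -/
theorem isNoetherianRing_of_exhausts_of_isRegularLocalRing (O : ValuationSubring K)
    (A : Subalgebra k K) (hk : ∀ c : k, algebraMap k K c ∈ O) (hA : A.FG)
    (hfr : IsFractionRing ↥A K) (hAO : A.toSubring ≤ O.toSubring)
    (hexh : ∀ x : K, x ∈ O → ∃ m : ℕ, x ∈ tower O A m) (m : ℕ)
    (hreg : IsRegularLocalRing ↥(tower O A m)) : IsNoetherianRing ↥O := by
  have hT : IsNoetherianRing ↥(tower O A m) := stub_towerNoetherian k K O A hk hA hfr hAO m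
  have heq := toSubring_eq_tower_of_exhausts_of_isRegularLocalRing O A hk hA hfr hAO hexh m hreg
  let e : ↥(tower O A m).toSubring ≃+* ↥O.toSubring := RingEquiv.subringCongr heq
  exact isNoetherianRing_of_ringEquiv (R := ↥(tower O A m)) (S := ↥O) e

/-- **In a NON-noetherian `O` exhausted by its tower, NO stage is regular.** [folklore] -/
theorem not_isRegularLocalRing_tower_of_exhausts (O : ValuationSubring K) (A : Subalgebra k K)
    (hk : ∀ c : k, algebraMap k K c ∈ O) (hA : A.FG) (hfr : IsFractionRing ↥A K)
    (hAO : A.toSubring ≤ O.toSubring) (hN : ¬ IsNoetherianRing ↥O)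
    (hexh : ∀ x : K, x ∈ O → ∃ m : ℕ, x ∈ tower O A m) (m : ℕ) :
    ¬ IsRegularLocalRing ↥(tower O A m) := fun hreg =>
  hN (isNoetherianRing_of_exhausts_of_isRegularLocalRing O A hk hA hfr hAO hexh m hreg)

/-- The kernel hypothesis `hker` of the line's stubs, at `O' := O`, says `O` is not noetherian.
[folklore] -/
theorem not_isNoetherianRing_of_hker (O : ValuationSubring K) (A : Subalgebra k K)
    (hk : ∀ c : k, algebraMap k K c ∈ O) (hA : A.FG) (hfr : IsFractionRing ↥A K)
    (hAO : A.toSubring ≤ O.toSubring)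
    (hker : ∀ O' : ValuationSubring K,
      (∀ m : ℕ, ∀ s ∈ tower O A m, s ∈ O' ∧ (s⁻¹ ∈ O' → s⁻¹ ∈ O)) → ¬ IsNoetherianRing ↥O') :
    ¬ IsNoetherianRing ↥O :=
  hker O fun m _s hs => ⟨(tn_tower_invariant O A hk hA hfr hAO m).2.1 hs, id⟩

/-- **SURFACE KERNEL: no stage is ever regular** (unconditional, no `P`/`D`). Under the kernel
hypothesis `hker` in transcendence degree `≤ 2` the tower exhausts `O` (`surfaceKernel_exhausts`)
and `O` is not noetherian, so a regular stage — which would freeze the tower and make `O = T_m`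
noetherian — does not exist. [folklore] -/
theorem surfaceKernel_not_isRegularLocalRing_tower (O : ValuationSubring K) (A : Subalgebra k K)
    (hk : ∀ c : k, algebraMap k K c ∈ O) (hA : A.FG) (hfr : IsFractionRing ↥A K)
    (hAO : A.toSubring ≤ O.toSubring)
    (hker : ∀ O' : ValuationSubring K,
      (∀ m : ℕ, ∀ s ∈ tower O A m, s ∈ O' ∧ (s⁻¹ ∈ O' → s⁻¹ ∈ O)) → ¬ IsNoetherianRing ↥O')
    (htr : Algebra.trdeg k K ≤ 2) (m : ℕ) : ¬ IsRegularLocalRing ↥(tower O A m) :=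
  not_isRegularLocalRing_tower_of_exhausts O A hk hA hfr hAO
    (not_isNoetherianRing_of_hker O A hk hA hfr hAO hker)
    (surfaceKernel_exhausts O A hk hA hfr hAO hker htr) m

/-- **The surface kernel stubs are contradiction claims.** Under `hker` and `tr.deg ≤ 2` the
conclusion `∃ m, IsRegularLocalRing (T_m)` of `stub_kernelRankOneSurface` (v6) /
`stub_sandwichedTermination` (v7) is equivalent to `False`: the stubs assert that NO datum satisfies
their hypotheses (given `Persistence`, `StrictDrop`). Consequences: a "non-vacuity certificate" for
those hypotheses would REFUTE the stub modulo `P ∧ D`; provers must derive `False` from an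
infinite all-singular exhausting tower; idea cards must supply an invariant that cannot drop
infinitely often along such a tower. [folklore] -/
theorem surfaceKernel_conclusion_iff_false (O : ValuationSubring K) (A : Subalgebra k K)
    (hk : ∀ c : k, algebraMap k K c ∈ O) (hA : A.FG) (hfr : IsFractionRing ↥A K)
    (hAO : A.toSubring ≤ O.toSubring)
    (hker : ∀ O' : ValuationSubring K,
      (∀ m : ℕ, ∀ s ∈ tower O A m, s ∈ O' ∧ (s⁻¹ ∈ O' → s⁻¹ ∈ O)) → ¬ IsNoetherianRing ↥O')
    (htr : Algebra.trdeg k K ≤ 2) :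
    (∃ m : ℕ, IsRegularLocalRing ↥(tower O A m)) ↔ False :=
  ⟨fun ⟨m, hreg⟩ => surfaceKernel_not_isRegularLocalRing_tower O A hk hA hfr hAO hker htr m hreg,
    False.elim⟩

end Summit.ResolutionOfSingularities.ResolutionOfSingularities.Theorems.NoZeno.Negative

end
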